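import Literature.MathematicalPhysics.QuantumFieldTheory.Balaban1983to89.HiggsCovariancePos
import Literature.MathematicalPhysics.QuantumFieldTheory.Balaban1983to89.B1Eq31Concrete

/-!
# `Balaban1983to89.HiggsCovarianceCont` — T. Bałaban, *(Higgs)₂,₃ quantum fields in a finite volume. I. A lower bound*,
Commun. Math. Phys. **85** (1982) 603–626 [Balaban1982Higgs1], (2.20) p. 610 and (3.28)–(3.29) p. 617: the propagator
`G^ε_k(Ω, A)` of (2.20) is BOUNDED by `m⁻²` and depends CONTINUOUSLY on the background field `A` (jointly with the
field it acts on); consequently the background scalar configuration `φ^{(k),ε} = a_k(L^kε)^{−2}G^ε_k(A^{(k),ε})Q^*_k(A^{(k),ε})φ`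
of (3.29) is jointly continuous in `(A, φ)` and the characteristic function `χ_k(φ)` of (3.28) — the inner weight of the
induction step (3.26) — is jointly MEASURABLE in `(A, φ)`.  PROVED for the concrete carriers `…HiggsLattice` /
`…HiggsAveraging` / `…HiggsCovariance`, on top of `…HiggsCovariancePos` (existence of `G^ε_k`) and `…B1Eq31Concrete`
(the concrete `χ`'s)

statement-level skeleton of published theorems with citation tags; proofs where landed; nothing here is a claim about the Yang–Mills mass gap

PDF held: `paper:balaban1982-cmp85-higgs23-i` (journal page = PDF page + 602).  Displays read from the ×2 renders
`run/shared/lean/pub/pub-balaban/b2b-balaban-ref1/pages/1982-cmp85-higgs23-I/1982-cmp85-higgs23-I-p008, p015-x2.png`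
(pp. 610, 617), never from the OCR layer.

CITATION HEADER (lean-in-tree rule).  lit-balaban typed skeleton (HOME `run/shared/lean/pub/lit-balaban/`), carrier API
for SKELETON rows **B1.Eq2.20** ((2.20) `G^ε_k(Ω, A)`), **B1.Eq3.29** (the background fields), **B1.Eq3.27-3.28** /
**B1.Eq3.26** (the weights `χ_k(A)χ_k(φ)` of the induction hypothesis) — owners r01/r12/r14; rows of record unchanged.
WHAT IS REPRODUCED (the analytic facts about the printed objects that every later use of them in integrals
`∫dA∫dφ χ_k(A)χ_k(φ)…` (3.26) p. 617 presupposes; the paper uses them silently): (§1) the scalar product (1.5) p. 604 is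
an inner product — Cauchy–Schwarz, the norm `|f| = ⟨f,f⟩^{1/2}`, triangle inequality, domination of the values
`η^{d/2}|f(x)| ≤ |f|` (`sNorm`, `abs_siteInner_le`, `sNorm_add_le`, `sqrt_mul_norm_apply_le`); (§2) **`|G^ε_k(Ω,A)ψ| ≤ m⁻²|ψ|`**
(`msq_mul_sNorm_propagatorK_le`, from the coercivity `HiggsCovariancePos.siteInner_covOpK_ge`); (§3) the resolvent
identity `G(A)ψ − G(A')ψ = G(A)[(T(A') − T(A))G(A')ψ]` for `T(A) = −Δ^{ε,N}_{A,Ω} + m² + a_k(L^kε)^{−2}P_k(A)`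
(`propagatorK_sub`); (§4) joint continuity of `(A, φ) ↦ T(A)φ` (`continuous_covOpK`; the transports
`U(A(Γ^{(k)}_{y,x}))` of `Q_k(A)`, `Q_k^*(A)` (2.11)/(2.20) depend continuously on `A`: `continuous_multiContourSum`,
`continuous_avgQkLin`, `continuous_avgQkAdj`); (§5) **joint continuity of `(A, ψ) ↦ G^ε_k(Ω, A)ψ`**
(`continuous_propagatorK` along any continuous family, `continuous_propagatorK₂` on the product, for `m² > 0`, `a_k ≥ 0`); (§6) joint continuity of `(A, φ) ↦ φ^{(k),ε}` (3.29)
(`continuous_bgScalar`) and **joint measurability of `(A, φ) ↦ χ_k(φ)` (3.28) and of `χ_k(A)χ_k(φ)`**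
(`measurable_chiKφ`, `measurable_chiK`) — the `hχ₀`-type hypothesis for the inner weight of the next renormalization
step (cf. `B1Ineq36HiggsModel.lowerStep36`).
DELIBERATELY NOT HERE: analyticity of `G^ε_k(Ω, A)` in `A` and the kernel bounds of Props. 2.1–2.3 (rows B1.Prop2.x).
Unit `lit-balaban-typer` gen 3 (literature-prover-lit-balaban-typer-g3-0); HOME/FILED.md records the proposal.
-/

open scoped BigOperators InnerProductSpace
open _root_.MeasureTheory Filter
open scoped Topology

namespace Literature.MathematicalPhysics.QuantumFieldTheory.Balaban1983to89.HiggsCovarianceCont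

open Literature.MathematicalPhysics.QuantumFieldTheory.Balaban1983to89.HiggsLattice
open Literature.MathematicalPhysics.QuantumFieldTheory.Balaban1983to89.HiggsAveraging
open Literature.MathematicalPhysics.QuantumFieldTheory.Balaban1983to89.HiggsCovariance
open Literature.MathematicalPhysics.QuantumFieldTheory.Balaban1983to89.HiggsCovariancePos
open Literature.MathematicalPhysics.QuantumFieldTheory.Balaban1983to89.B3MultiscaleFields (toSite ofSite topPiece)
open Literature.MathematicalPhysics.QuantumFieldTheory.Balaban1983to89.B1Eq31Concrete
  (chiSmall measurable_chiSmall chi0φ chiKA chiKφ bgVec bgScalar continuous_chargeU continuous_covLaplacianN_apply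
    measurable_chiKA toSite_bgVec)

variable {P : Params} {k N : ℕ}

/-! ## 1. The scalar product (1.5) as an inner product: norm, Cauchy–Schwarz, triangle inequality -/

section Norm

/-- The scalar product (1.5) p. 604 is `η^d` times the inner product of the Hilbert space `ℓ²(T; ℝ^N)`
(`PiLp 2`). PROVED. [cite: Balaban1982Higgs1, (1.5) p.604] -/
theorem siteInner_eq_inner_toLp (f g : ScalarField P k N) :
    siteInner f g = P.mesh k ^ P.d * ⟪(WithLp.toLp 2 f : PiLp 2 fun _ : Site P k => E N), WithLp.toLp 2 g⟫_ℝ := by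
  rw [PiLp.inner_apply, Finset.mul_sum]
  rfl

/-- The norm `|f| = ⟨f, f⟩^{1/2}` of the scalar product (1.5) p. 604 (*"|f|"* in (1.14), (3.1) …). [cite: Balaban1982Higgs1, (1.5) p.604] -/
noncomputable def sNorm (f : ScalarField P k N) : ℝ := Real.sqrt (siteInner f f)

/-- `|f| = η^{d/2} ‖f‖_{ℓ²}`. PROVED. [cite: Balaban1982Higgs1, (1.5) p.604] -/
theorem sNorm_eq (f : ScalarField P k N) :
    sNorm f = Real.sqrt (P.mesh k ^ P.d) * ‖(WithLp.toLp 2 f : PiLp 2 fun _ : Site P k => E N)‖ := by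
  unfold sNorm
  rw [siteInner_eq_inner_toLp, real_inner_self_eq_norm_sq, Real.sqrt_mul (pow_nonneg (P.mesh_pos k).le _),
    Real.sqrt_sq (norm_nonneg _)]

/-- `|f| ≥ 0`. [cite: Balaban1982Higgs1, (1.5) p.604] -/
theorem sNorm_nonneg (f : ScalarField P k N) : 0 ≤ sNorm f := Real.sqrt_nonneg _

/-- `|f|² = ⟨f, f⟩`. [cite: Balaban1982Higgs1, (1.5) p.604] -/
theorem sNorm_sq (f : ScalarField P k N) : sNorm f ^ 2 = siteInner f f :=
  Real.sq_sqrt (siteInner_self_nonneg f)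

/-- `|0| = 0`. [cite: Balaban1982Higgs1, (1.5) p.604] -/
theorem sNorm_zero : sNorm (0 : ScalarField P k N) = 0 := by
  rw [sNorm_eq]
  simp

/-- **Cauchy–Schwarz for (1.5)**: `|⟨f, g⟩| ≤ |f| |g|`. PROVED. [cite: Balaban1982Higgs1, (1.5) p.604] -/
theorem abs_siteInner_le (f g : ScalarField P k N) : |siteInner f g| ≤ sNorm f * sNorm g := by
  rw [siteInner_eq_inner_toLp, sNorm_eq, sNorm_eq, abs_mul, abs_of_nonneg (pow_nonneg (P.mesh_pos k).le _)]
  have hcs := abs_real_inner_le_norm (WithLp.toLp 2 f : PiLp 2 fun _ : Site P k => E N) (WithLp.toLp 2 g)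
  have hm : Real.sqrt (P.mesh k ^ P.d) * Real.sqrt (P.mesh k ^ P.d) = P.mesh k ^ P.d :=
    Real.mul_self_sqrt (pow_nonneg (P.mesh_pos k).le _)
  calc P.mesh k ^ P.d * |⟪(WithLp.toLp 2 f : PiLp 2 fun _ : Site P k => E N), WithLp.toLp 2 g⟫_ℝ|
      ≤ P.mesh k ^ P.d * (‖(WithLp.toLp 2 f : PiLp 2 fun _ : Site P k => E N)‖
          * ‖(WithLp.toLp 2 g : PiLp 2 fun _ : Site P k => E N)‖) :=
        mul_le_mul_of_nonneg_left hcs (pow_nonneg (P.mesh_pos k).le _)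
    _ = Real.sqrt (P.mesh k ^ P.d) * Real.sqrt (P.mesh k ^ P.d)
          * (‖(WithLp.toLp 2 f : PiLp 2 fun _ : Site P k => E N)‖
            * ‖(WithLp.toLp 2 g : PiLp 2 fun _ : Site P k => E N)‖) := by rw [hm]
    _ = Real.sqrt (P.mesh k ^ P.d) * ‖(WithLp.toLp 2 f : PiLp 2 fun _ : Site P k => E N)‖
          * (Real.sqrt (P.mesh k ^ P.d) * ‖(WithLp.toLp 2 g : PiLp 2 fun _ : Site P k => E N)‖) := by ring

/-- **Triangle inequality for (1.5)**: `|f + g| ≤ |f| + |g|`. PROVED. [cite: Balaban1982Higgs1, (1.5) p.604] -/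
theorem sNorm_add_le (f g : ScalarField P k N) : sNorm (f + g) ≤ sNorm f + sNorm g := by
  rw [sNorm_eq, sNorm_eq, sNorm_eq, ← mul_add, WithLp.toLp_add]
  exact mul_le_mul_of_nonneg_left (norm_add_le _ _) (Real.sqrt_nonneg _)

/-- `|c f| = |c| |f|`. [cite: Balaban1982Higgs1, (1.5) p.604] -/
theorem sNorm_smul (c : ℝ) (f : ScalarField P k N) : sNorm (c • f) = |c| * sNorm f := by
  rw [sNorm_eq, sNorm_eq, WithLp.toLp_smul, norm_smul, Real.norm_eq_abs]
  ring

/-- `|−f| = |f|` and `|f − g| = |g − f|`. [cite: Balaban1982Higgs1, (1.5) p.604] -/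
theorem sNorm_sub_comm (f g : ScalarField P k N) : sNorm (f - g) = sNorm (g - f) := by
  rw [sNorm_eq, sNorm_eq, WithLp.toLp_sub, WithLp.toLp_sub, norm_sub_rev]

/-- **The values are dominated by the norm**: `η^{d/2} |f(x)| ≤ |f|` (one term of the sum `Σ_y η^d|f(y)|²`). PROVED. [cite: Balaban1982Higgs1, (1.5) p.604] -/
theorem sqrt_mul_norm_apply_le (f : ScalarField P k N) (x : Site P k) :
    Real.sqrt (P.mesh k ^ P.d) * ‖f x‖ ≤ sNorm f := by
  have hm : 0 ≤ P.mesh k ^ P.d := pow_nonneg (P.mesh_pos k).le _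
  have hle : P.mesh k ^ P.d * ‖f x‖ ^ 2 ≤ siteInner f f := by
    rw [siteInner_self_eq]
    exact Finset.single_le_sum (f := fun y => P.mesh k ^ P.d * ‖f y‖ ^ 2)
      (fun y _ => mul_nonneg hm (sq_nonneg _)) (Finset.mem_univ x)
  unfold sNorm
  calc Real.sqrt (P.mesh k ^ P.d) * ‖f x‖ = Real.sqrt (P.mesh k ^ P.d * ‖f x‖ ^ 2) := by
        rw [Real.sqrt_mul hm, Real.sqrt_sq (norm_nonneg _)]
    _ ≤ Real.sqrt (siteInner f f) := Real.sqrt_le_sqrt hle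

/-- The sup-norm of the carrier is dominated by the (1.5)-norm: `‖f‖ ≤ η^{−d/2}|f|`. PROVED. [cite: Balaban1982Higgs1, (1.5) p.604] -/
theorem norm_le_sNorm (f : ScalarField P k N) : ‖f‖ ≤ (Real.sqrt (P.mesh k ^ P.d))⁻¹ * sNorm f := by
  have hs : 0 < Real.sqrt (P.mesh k ^ P.d) := Real.sqrt_pos.mpr (pow_pos (P.mesh_pos k) _)
  refine (pi_norm_le_iff_of_nonneg (mul_nonneg (inv_nonneg.mpr hs.le) (sNorm_nonneg f))).mpr fun x => ?_
  rw [le_inv_mul_iff₀ hs]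
  exact sqrt_mul_norm_apply_le f x

/-- `(f, g) ↦ ⟨f, g⟩` is continuous. [cite: Balaban1982Higgs1, (1.5) p.604] -/
theorem continuous_siteInner :
    Continuous fun p : ScalarField P k N × ScalarField P k N => siteInner p.1 p.2 := by
  unfold siteInner
  refine continuous_finsetSum _ fun x _ => ?_
  exact ((((continuous_apply x).comp continuous_fst).inner ((continuous_apply x).comp continuous_snd)).const_mul _)

/-- `f ↦ |f|` is continuous. [cite: Balaban1982Higgs1, (1.5) p.604] -/
theorem continuous_sNorm : Continuous (sNorm : ScalarField P k N → ℝ) :=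
  Real.continuous_sqrt.comp (continuous_siteInner.comp (continuous_id.prodMk continuous_id))

end Norm

/-! ## 2. `|G^ε_k(Ω, A)ψ| ≤ m⁻²|ψ|` -/

section Bound

/-- **The propagator (2.20) is bounded by `m⁻²`**: `m² |G^ε_k(Ω,A)ψ| ≤ |ψ|` for `m² > 0`, `a_k ≥ 0` — from the
coercivity `⟨φ, Tφ⟩ ≥ m²⟨φ, φ⟩` at `φ = Gψ` and Cauchy–Schwarz. PROVED. [cite: Balaban1982Higgs1, (2.20) p.610] -/
theorem msq_mul_sNorm_propagatorK_le (C : ChargeData N) (Ω : Finset (Site P 0)) (A : VecField P 0) {msq : ℝ}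
    (hmsq : 0 < msq) (a : ℝ) (k : ℕ) (hak : 0 ≤ B1.aSeq a P.L k) (ψ : ScalarField P 0 N) :
    msq * sNorm (propagatorK C Ω A msq a k ψ) ≤ sNorm ψ := by
  set G := propagatorK C Ω A msq a k ψ with hG
  have hco := siteInner_covOpK_ge C Ω A msq a k hak G
  rw [hG, covOpK_propagatorK_apply C Ω A hmsq a k hak ψ, ← hG] at hco
  have hcs : siteInner G ψ ≤ sNorm G * sNorm ψ := (le_abs_self _).trans (abs_siteInner_le G ψ)
  have hsq : msq * sNorm G ^ 2 ≤ sNorm G * sNorm ψ := by rw [sNorm_sq]; exact hco.trans hcs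
  by_cases h0 : sNorm G = 0
  · rw [h0, mul_zero]; exact sNorm_nonneg ψ
  · have hpos : 0 < sNorm G := lt_of_le_of_ne (sNorm_nonneg G) (Ne.symm h0)
    have : msq * sNorm G * sNorm G ≤ sNorm ψ * sNorm G := by nlinarith
    exact le_of_mul_le_mul_right this hpos

end Bound

/-! ## 3. The resolvent identity -/

section Resolvent

/-- **Resolvent identity** for `T(A) = −Δ^{ε,N}_{A,Ω} + m² + a_k(L^kε)^{−2}P_k(A)` and `G(A) = T(A)^{−1}`:
`G(A)ψ − G(A')ψ' = G(A)(ψ − ψ') + G(A)[(T(A') − T(A))(G(A')ψ')]`. PROVED (two-sided inverse, `HiggsCovariancePos`). [cite: Balaban1982Higgs1, (2.20) p.610] -/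
theorem propagatorK_sub (C : ChargeData N) (Ω : Finset (Site P 0)) (A A' : VecField P 0) {msq : ℝ}
    (hmsq : 0 < msq) (a : ℝ) (k : ℕ) (hak : 0 ≤ B1.aSeq a P.L k) (ψ ψ' : ScalarField P 0 N) :
    propagatorK C Ω A msq a k ψ - propagatorK C Ω A' msq a k ψ'
      = propagatorK C Ω A msq a k (ψ - ψ')
        + propagatorK C Ω A msq a k
            ((covOpK C Ω A' msq a k - covOpK C Ω A msq a k) (propagatorK C Ω A' msq a k ψ')) := by
  rw [LinearMap.sub_apply, map_sub, map_sub, covOpK_propagatorK_apply C Ω A' hmsq a k hak ψ',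
    propagatorK_covOpK_apply C Ω A hmsq a k hak]
  abel

end Resolvent

/-! ## 4. Continuity of `(A, φ) ↦ T(A)φ` (the transports depend continuously on `A`) -/

section OperatorContinuity

variable {X : Type*} [TopologicalSpace X]

/-- `A ↦ A(⟨u, u + nεe_μ⟩)` ((2.3) p. 608) is continuous. [cite: Balaban1982Higgs1, (2.3) p.608] -/
theorem continuous_segSum (u : Site P 0) (μ : Fin P.d) (n : ℕ) :
    Continuous fun A : VecField P 0 => segSum A u μ n := by
  unfold segSum
  exact continuous_finsetSum _ fun i _ => continuous_apply _

/-- `A ↦ A(Γ_{y,x})` ((2.1) p. 608) is continuous. [cite: Balaban1982Higgs1, (2.1) p.608] -/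
theorem continuous_contourSum (y x : Site P 0) : Continuous fun A : VecField P 0 => contourSum A y x := by
  unfold contourSum
  exact continuous_finsetSum _ fun i _ => continuous_segSum _ _ _

/-- `A ↦ A(Γ^{(k)}_{x_k,x})` ((2.2) p. 608) is continuous. [cite: Balaban1982Higgs1, (2.2) p.608] -/
theorem continuous_multiContourSum (k : ℕ) (x : Site P 0) :
    Continuous fun A : VecField P 0 => multiContourSum A k x := by
  unfold multiContourSum
  exact continuous_finsetSum _ fun j _ => continuous_contourSum _ _

/-- **`(A, f) ↦ Q_k(A)f` (2.11) is jointly continuous** (along any continuous family of fields). [cite: Balaban1982Higgs1, (2.11) p.609] -/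
theorem continuous_avgQkLin (C : ChargeData N) (k : ℕ) {A : X → VecField P 0} {f : X → ScalarField P 0 N}
    (hA : Continuous A) (hf : Continuous f) : Continuous fun t => avgQkLin C (A t) k (f t) := by
  refine continuous_pi fun y => ?_
  simp_rw [avgQkLin_apply, avgQk_apply]
  have hfx : ∀ x : Site P 0, Continuous fun t => f t x := fun x => (continuous_apply x).comp hf
  have hterm : ∀ x : Site P 0, Continuous fun t => C.U (P.mesh 0) (multiContourSum (A t) k x) (f t x) :=
    fun x => ((continuous_chargeU C (P.mesh 0)).comp ((continuous_multiContourSum k x).comp hA)).clm_apply (hfx x)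
  exact (continuous_finsetSum _ fun x _ => hterm x).const_smul (((P.L : ℝ) ^ (k * P.d))⁻¹)

/-- **`(A, ψ) ↦ Q_k^*(A)ψ` (2.20) is jointly continuous** (`U* = U(−A(Γ))`). [cite: Balaban1982Higgs1, (2.20) p.610] -/
theorem continuous_avgQkAdj (C : ChargeData N) (k : ℕ) {A : X → VecField P 0} {g : X → ScalarField P k N}
    (hA : Continuous A) (hg : Continuous g) : Continuous fun t => avgQkAdj C (A t) k (g t) := by
  refine continuous_pi fun x => ?_
  have happ : ∀ t, avgQkAdj C (A t) k (g t) x = C.U (P.mesh 0) (-(multiContourSum (A t) k x)) (g t (blockIter k x)) := by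
    intro t
    simp [avgQkAdj, C.star_U]
  simp_rw [happ]
  exact ((continuous_chargeU C (P.mesh 0)).comp (((continuous_multiContourSum k x).comp hA).neg)).clm_apply
    ((continuous_apply (blockIter k x)).comp hg)

/-- One forward Neumann term as a function: `fwdTerm φ = 1_{⟨x,x+ηe_μ⟩⊂Ω}(φ(x) − U(A_{⟨x,x+ηe_μ⟩})φ(x+ηe_μ))`. [cite: Balaban1982Higgs1, (2.17) p.610] -/
theorem fwdTerm_apply (C : ChargeData N) (Ω : Finset (Site P k)) (A : VecField P k) (x : Site P k) (μ : Fin P.d)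
    (φ : ScalarField P k N) :
    fwdTerm C Ω A x μ φ
      = if x ∈ Ω ∧ x.shift μ ∈ Ω then φ x - C.U (P.mesh k) (A ⟨x, μ⟩) (φ (x.shift μ)) else 0 := by
  unfold fwdTerm
  split_ifs <;> simp

/-- One backward Neumann term as a function: `bwdTerm φ = 1_{⟨x−ηe_μ,x⟩⊂Ω}(φ(x) − U(−A_{⟨x−ηe_μ,x⟩})φ(x−ηe_μ))`. [cite: Balaban1982Higgs1, (2.17) p.610] -/
theorem bwdTerm_apply (C : ChargeData N) (Ω : Finset (Site P k)) (A : VecField P k) (x : Site P k) (μ : Fin P.d)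
    (φ : ScalarField P k N) :
    bwdTerm C Ω A x μ φ
      = if x ∈ Ω ∧ x.unshift μ ∈ Ω then φ x - C.U (P.mesh k) (-(A ⟨x.unshift μ, μ⟩)) (φ (x.unshift μ)) else 0 := by
  unfold bwdTerm
  split_ifs <;> simp [C.star_U]

/-- **`(A, φ) ↦ −Δ^{η,N}_{A,Ω}φ` is jointly continuous** for every `Ω` (the indicator of `b ⊂ Ω` is constant in the
fields). [cite: Balaban1982Higgs1, (2.17) p.610] -/
theorem continuous_covLaplacianN (C : ChargeData N) (Ω : Finset (Site P k)) {A : X → VecField P k}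
    {φ : X → ScalarField P k N} (hA : Continuous A) (hφ : Continuous φ) :
    Continuous fun t => covLaplacianN C Ω (A t) (φ t) := by
  refine continuous_pi fun x => ?_
  have happ : ∀ t, covLaplacianN C Ω (A t) (φ t) x
      = ((P.mesh k)⁻¹ ^ 2) • ∑ μ : Fin P.d, (fwdTerm C Ω (A t) x μ (φ t) + bwdTerm C Ω (A t) x μ (φ t)) := by
    intro t
    simp only [covLaplacianN, LinearMap.pi_apply, LinearMap.smul_apply, LinearMap.coe_sum, Finset.sum_apply,
      LinearMap.add_apply]
  simp_rw [happ, fwdTerm_apply, bwdTerm_apply]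
  have hAb : ∀ b : PBond P k, Continuous fun t => A t b := fun b => (continuous_apply b).comp hA
  have hφy : ∀ y : Site P k, Continuous fun t => φ t y := fun y => (continuous_apply y).comp hφ
  have hfwd : ∀ μ : Fin P.d, Continuous fun t =>
      if x ∈ Ω ∧ x.shift μ ∈ Ω then φ t x - C.U (P.mesh k) (A t ⟨x, μ⟩) (φ t (x.shift μ)) else 0 := by
    intro μ
    by_cases h : x ∈ Ω ∧ x.shift μ ∈ Ω
    · simp only [if_pos h]
      exact (hφy x).sub (((continuous_chargeU C (P.mesh k)).comp (hAb ⟨x, μ⟩)).clm_apply (hφy (x.shift μ)))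
    · simp only [if_neg h]
      exact continuous_const
  have hbwd : ∀ μ : Fin P.d, Continuous fun t =>
      if x ∈ Ω ∧ x.unshift μ ∈ Ω then φ t x - C.U (P.mesh k) (-(A t ⟨x.unshift μ, μ⟩)) (φ t (x.unshift μ))
      else 0 := by
    intro μ
    by_cases h : x ∈ Ω ∧ x.unshift μ ∈ Ω
    · simp only [if_pos h]
      exact (hφy x).sub
        (((continuous_chargeU C (P.mesh k)).comp (hAb ⟨x.unshift μ, μ⟩).neg).clm_apply (hφy (x.unshift μ)))
    · simp only [if_neg h]
      exact continuous_const
  exact (continuous_finsetSum _ fun μ _ => (hfwd μ).add (hbwd μ)).const_smul ((P.mesh k)⁻¹ ^ 2)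

/-- **`(A, φ) ↦ T(A)φ = (−Δ^{ε,N}_{A,Ω} + m² + a_k(L^kε)^{−2}P_k(A))φ` is jointly continuous.** [cite: Balaban1982Higgs1, (2.20) p.610] -/
theorem continuous_covOpK (C : ChargeData N) (Ω : Finset (Site P 0)) (msq a : ℝ) (k : ℕ) {A : X → VecField P 0}
    {φ : X → ScalarField P 0 N} (hA : Continuous A) (hφ : Continuous φ) :
    Continuous fun t => covOpK C Ω (A t) msq a k (φ t) := by
  have h : Continuous fun t => covLaplacianN C Ω (A t) (φ t) + msq • φ t
      + (B1.aSeq a P.L k * ((P.mesh k)⁻¹ ^ 2)) • avgQkAdj C (A t) k (avgQkLin C (A t) k (φ t)) :=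
    ((continuous_covLaplacianN C Ω hA hφ).add (hφ.const_smul msq)).add
      ((continuous_avgQkAdj C k hA (continuous_avgQkLin C k hA hφ)).const_smul
        (B1.aSeq a P.L k * ((P.mesh k)⁻¹ ^ 2)))
  refine h.congr fun t => ?_
  simp [covOpK, projPk]

end OperatorContinuity

/-! ## 5. Joint continuity of `(A, ψ) ↦ G^ε_k(Ω, A)ψ` -/

section PropagatorContinuity

variable {X : Type*} [TopologicalSpace X]

/-- **`(A, ψ) ↦ G^ε_k(Ω, A)ψ` is jointly continuous** (along any continuous family) for `m² > 0`, `a_k ≥ 0`: by the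
resolvent identity and the bound `|G| ≤ m⁻²`, `|G(A)ψ − G(A₀)ψ₀| ≤ m⁻²(|ψ − ψ₀| + |(T(A₀) − T(A))G(A₀)ψ₀|) → 0`. PROVED. [cite: Balaban1982Higgs1, (2.20) p.610] -/
theorem continuous_propagatorK (C : ChargeData N) (Ω : Finset (Site P 0)) {msq : ℝ} (hmsq : 0 < msq) (a : ℝ)
    (k : ℕ) (hak : 0 ≤ B1.aSeq a P.L k) {A : X → VecField P 0} {ψ : X → ScalarField P 0 N} (hA : Continuous A)
    (hψ : Continuous ψ) : Continuous fun t => propagatorK C Ω (A t) msq a k (ψ t) := by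
  refine continuous_iff_continuousAt.mpr fun t₀ => ?_
  set v₀ := propagatorK C Ω (A t₀) msq a k (ψ t₀) with hv₀
  -- the majorant
  let g : X → ℝ := fun t =>
    (Real.sqrt (P.mesh 0 ^ P.d))⁻¹ * (msq⁻¹ * (sNorm (ψ t - ψ t₀)
      + sNorm (covOpK C Ω (A t₀) msq a k v₀ - covOpK C Ω (A t) msq a k v₀)))
  have hg_cont : Continuous g := by
    have h1 : Continuous fun t => sNorm (ψ t - ψ t₀) := continuous_sNorm.comp (hψ.sub continuous_const)
    have h2 : Continuous fun t => sNorm (covOpK C Ω (A t₀) msq a k v₀ - covOpK C Ω (A t) msq a k v₀) :=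
      continuous_sNorm.comp (continuous_const.sub (continuous_covOpK C Ω msq a k hA continuous_const))
    exact ((h1.add h2).const_mul _).const_mul _
  have hg0 : g t₀ = 0 := by
    simp only [g, sub_self, sNorm_zero, add_zero, mul_zero]
  -- the bound
  have hbound : ∀ t, ‖propagatorK C Ω (A t) msq a k (ψ t) - propagatorK C Ω (A t₀) msq a k (ψ t₀)‖ ≤ g t := by
    intro t
    have hres := propagatorK_sub C Ω (A t) (A t₀) hmsq a k hak (ψ t) (ψ t₀)
    rw [← hv₀] at hres
    have hs : sNorm (propagatorK C Ω (A t) msq a k (ψ t) - propagatorK C Ω (A t₀) msq a k (ψ t₀))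
        ≤ msq⁻¹ * (sNorm (ψ t - ψ t₀) + sNorm (covOpK C Ω (A t₀) msq a k v₀ - covOpK C Ω (A t) msq a k v₀)) := by
      rw [hres]
      refine (sNorm_add_le _ _).trans ?_
      rw [mul_add]
      have hb1 := msq_mul_sNorm_propagatorK_le C Ω (A t) hmsq a k hak (ψ t - ψ t₀)
      have hb2 := msq_mul_sNorm_propagatorK_le C Ω (A t) hmsq a k hak
        ((covOpK C Ω (A t₀) msq a k - covOpK C Ω (A t) msq a k) v₀)
      rw [LinearMap.sub_apply] at hb2
      refine add_le_add ?_ ?_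
      · rw [le_inv_mul_iff₀ hmsq]; exact hb1
      · rw [le_inv_mul_iff₀ hmsq]; exact hb2
    have hsq : 0 < Real.sqrt (P.mesh 0 ^ P.d) := Real.sqrt_pos.mpr (pow_pos (P.mesh_pos 0) _)
    calc ‖propagatorK C Ω (A t) msq a k (ψ t) - propagatorK C Ω (A t₀) msq a k (ψ t₀)‖
        ≤ (Real.sqrt (P.mesh 0 ^ P.d))⁻¹
            * sNorm (propagatorK C Ω (A t) msq a k (ψ t) - propagatorK C Ω (A t₀) msq a k (ψ t₀)) :=
          norm_le_sNorm _
      _ ≤ g t := mul_le_mul_of_nonneg_left hs (inv_nonneg.mpr hsq.le)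
  -- conclude
  rw [ContinuousAt, tendsto_iff_norm_sub_tendsto_zero]
  have hg_tend : Tendsto g (𝓝 t₀) (𝓝 0) := by
    have h := hg_cont.continuousAt (x := t₀)
    rwa [ContinuousAt, hg0] at h
  exact squeeze_zero (fun t => norm_nonneg _) hbound hg_tend

/-- Product form: `(A, ψ) ↦ G^ε_k(Ω, A)ψ` is continuous on `VecField × ScalarField`. [cite: Balaban1982Higgs1, (2.20) p.610] -/
theorem continuous_propagatorK₂ (C : ChargeData N) (Ω : Finset (Site P 0)) {msq : ℝ} (hmsq : 0 < msq) (a : ℝ)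
    (k : ℕ) (hak : 0 ≤ B1.aSeq a P.L k) :
    Continuous fun p : VecField P 0 × ScalarField P 0 N => propagatorK C Ω p.1 msq a k p.2 :=
  continuous_propagatorK C Ω hmsq a k hak continuous_fst continuous_snd

/-- For a FIXED field the propagator applied to it depends continuously on the background field `A`. [cite: Balaban1982Higgs1, (2.20) p.610] -/
theorem continuous_propagatorK_apply (C : ChargeData N) (Ω : Finset (Site P 0)) {msq : ℝ} (hmsq : 0 < msq) (a : ℝ)
    (k : ℕ) (hak : 0 ≤ B1.aSeq a P.L k) (ψ : ScalarField P 0 N) :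
    Continuous fun A : VecField P 0 => propagatorK C Ω A msq a k ψ :=
  continuous_propagatorK C Ω hmsq a k hak continuous_id continuous_const

end PropagatorContinuity

/-! ## 6. (3.29): `φ^{(k),ε}` is jointly continuous; (3.28): `χ_k(φ)` is jointly measurable -/

section ChiK

variable {X : Type*} [TopologicalSpace X]

/-- **(3.29): `(A^{bg}, φ) ↦ a_k(L^kε)^{−2}G^ε_k(A^{bg})Q^*_k(A^{bg})φ` is jointly continuous** in the background field and
the block field (`m² > 0`, `a_k ≥ 0`). PROVED. [cite: Balaban1982Higgs1, (3.29) p.617] -/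
theorem continuous_bgScalar (C : ChargeData N) {msq : ℝ} (hmsq : 0 < msq) (a : ℝ) (k : ℕ)
    (hak : 0 ≤ B1.aSeq a P.L k) {Abg : X → VecField P 0} {φ : X → ScalarField P k N} (hA : Continuous Abg)
    (hφ : Continuous φ) : Continuous fun t => bgScalar C msq a k (Abg t) (φ t) := by
  have h : Continuous fun t => (B1.aSeq a P.L k * (P.mesh k ^ 2)⁻¹) •
      propagatorK C Finset.univ (Abg t) msq a k (avgQkAdj C (Abg t) k (φ t)) :=
    (continuous_propagatorK C Finset.univ hmsq a k hak hA (continuous_avgQkAdj C k hA hφ)).const_smul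
      (B1.aSeq a P.L k * (P.mesh k ^ 2)⁻¹)
  refine h.congr fun t => ?_
  rw [B1Eq31Concrete.bgScalar_eq]

/-- The vector background field (3.29) `A ↦ A^{(k),ε}` (`B3MultiscaleFields.topPiece`) is continuous (linear on a
finite-dimensional space). PROVED. [cite: Balaban1982Higgs1, (3.29) p.617] -/
theorem continuous_bgVec (mu0sq a : ℝ) (k : ℕ) : Continuous fun A : VecField P k => bgVec (P := P) mu0sq a k A := by
  have hlin : IsLinearMap ℝ fun A : VecField P k => toSite (bgVec (P := P) mu0sq a k A) := by
    refine ⟨fun A B => ?_, fun c A => ?_⟩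
    · simp only [toSite_bgVec, B3MultiscaleFields.toSite_add, map_add, smul_add]
    · rw [toSite_bgVec, toSite_bgVec]
      have hs : toSite (c • A) = c • toSite A := by
        funext x
        ext μ
        rfl
      rw [hs, map_smul, map_smul, smul_comm]
  have hcont : Continuous fun A : VecField P k => toSite (bgVec (P := P) mu0sq a k A) :=
    (hlin.mk' _).continuous_of_finiteDimensional
  have hb : ∀ b : PBond P 0, Continuous fun A : VecField P k => bgVec (P := P) mu0sq a k A b := by
    intro b
    have hx : Continuous fun A : VecField P k => toSite (bgVec (P := P) mu0sq a k A) b.src b.dir :=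
      (PiLp.continuous_apply 2 (fun _ : Fin P.d => ℝ) b.dir).comp ((continuous_apply b.src).comp hcont)
    refine hx.congr fun A => ?_
    rfl
  exact continuous_pi hb

/-- Along a continuous family: `t ↦ A^{(k),ε}(A(t))` is continuous. [cite: Balaban1982Higgs1, (3.29) p.617] -/
theorem continuous_bgVec_comp (mu0sq a : ℝ) (k : ℕ) {A : X → VecField P k} (hA : Continuous A) :
    Continuous fun t => bgVec (P := P) mu0sq a k (A t) :=
  (continuous_bgVec mu0sq a k).comp hA

/-- **(3.28): `(A, φ) ↦ χ_k(φ)` is jointly measurable** (`m² > 0`, `a_k ≥ 0`): the background fields are continuous in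
`(A, φ)` and `(−Δ^ε_{A^{(k),ε}}φ^{(k),ε})(x)` is continuous in them. PROVED. [cite: Balaban1982Higgs1, (3.28) p.617] -/
theorem measurable_chiKφ (C : ChargeData N) (ℓ p mu0sq : ℝ) {msq : ℝ} (hmsq : 0 < msq) (a : ℝ) (k : ℕ)
    (hak : 0 ≤ B1.aSeq a P.L k) :
    Measurable fun q : VecField P k × ScalarField P k N => chiKφ C ℓ p mu0sq msq a k q.1 q.2 := by
  have hB : Continuous fun q : VecField P k × ScalarField P k N => bgVec (P := P) mu0sq a k q.1 :=
    continuous_bgVec_comp mu0sq a k continuous_fst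
  have hS : Continuous fun q : VecField P k × ScalarField P k N =>
      bgScalar C msq a k (bgVec (P := P) mu0sq a k q.1) q.2 :=
    continuous_bgScalar C hmsq a k hak hB continuous_snd
  have hL : Continuous fun q : VecField P k × ScalarField P k N =>
      covLaplacianN C Finset.univ (bgVec (P := P) mu0sq a k q.1) (bgScalar C msq a k (bgVec (P := P) mu0sq a k q.1) q.2) :=
    continuous_covLaplacianN C Finset.univ hB hS
  unfold chiKφ chi0φ
  refine measurable_chiSmall _ _ _ (fun x => ?_) (fun x => ?_)
  · exact (((continuous_apply x).comp hS).norm).measurable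
  · exact (((continuous_apply x).comp hL).norm).measurable

/-- **The weight `χ_k(A)χ_k(φ)` of (3.26) p. 617 is jointly measurable in `(A, φ)`** — the measurability hypothesis on
the inner weight when the `k`-th integral is subjected to the next renormalization step ((3.37) p. 618). PROVED. [cite: Balaban1982Higgs1, (3.26) p.617] -/
theorem measurable_chiK (C : ChargeData N) (ℓ p mu0sq : ℝ) {msq : ℝ} (hmsq : 0 < msq) (a : ℝ) (k : ℕ)
    (hak : 0 ≤ B1.aSeq a P.L k) :
    Measurable fun q : VecField P k × ScalarField P k N =>
      chiKA ℓ p mu0sq a k q.1 * chiKφ C ℓ p mu0sq msq a k q.1 q.2 :=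
  ((measurable_chiKA ℓ p mu0sq a k).comp measurable_fst).mul (measurable_chiKφ C ℓ p mu0sq hmsq a k hak)

end ChiK

end Literature.MathematicalPhysics.QuantumFieldTheory.Balaban1983to89.HiggsCovarianceCont
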